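import Summits.BirchSwinnertonDyer.BirchSwinnertonDyer.Theorems.AlignedTransportAtTwoMainConjectureOfRankZeroBSDAtTwoCubicOffStratumFukudaIndex
import Literature.NumberTheory.IwasawaTheory.CyclotomicTwoTotallyRamifiedNoSqrtTwo
import HarnessLib

/-!
# Route `AlignedTransportAtTwo`, crux C2 `MainConjectureOfRankZeroBSDAtTwo` (stmt-BirchSwinnertonDyer-22298):
# FUKUDA'S INDEX IS `0` FOR THE SEXTIC `ℚ(W[2])` OF EVERY GOOD-ORDINARY SEED-CELL CURVE WITH `E(ℚ)[2] = 0`, `Δ_W ∉ ℚ²` — OFF the stratum on `Δ_min ≡ 3 (mod 4)`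
# every prime of `ℚ(W[2])` above `2` (`e = 2`) ramifies again in `ℚ(W[2])(√2)`, by the element certificate alone (no inertia group needed for the sextic)

HONEST FRAMING (cell `bsd-f1-sign2`, WIDTH-5 attached prover seat `bsd-line-att-p5` gen 28 on line `birth` of the lead `bsd-line-att-p2`;
`--supports` stmt-BirchSwinnertonDyer-22298, closes nothing; BSD is NOT proved by any of this; the crux C2, its verdict «blocked-on
`Rank1Residual.GreenbergMuConjectureIrreducible`» and every registered stub are untouched). THEOREMS ONLY — no definition, no named fact, no `sorry`.
Companion of `…CubicOffStratumFukudaIndex` (the cubic `ℚ(β)`), for att-p3's SEXTIC carrier `T = ℚ(W[2])` of road (b″) / PFμ⁺ / the sextic criterion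
(att-p3 g26 `…SexticTowerGrowth`, `…SexticTowerLambda`: ON the stratum `2` is totally split in `T`). OFF the stratum:

* §1 `forall_sq_ne_two_divisionField_two_of_minimalDiscriminantInt_emod_four_eq_three` (`√2 ∉ ℚ(W[2])` on `Δ_min ≡ 3 (4)`: with `√2, √Δ_min ∈ T` every
  `e(𝔓|2)` would be divisible by `4`, but it is `2`); **`totallyRamifiedFrom_zero_divisionField_two_of_minimalDiscriminantInt_emod_four_eq_three`**: every
  cyclotomic `ℤ₂`-extension `κ` of `T` has `TotallyRamifiedFrom κ 0` — `T₁ = κ.layer 1 ∋ √2` (bsd-wall `exists_sq_eq_two_layer_one_of_forall_sq_ne_two`,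
  `4 ∤ 6`) and `√Δ_min`, so `4 ∣ e(Q|2) = 2·e(Q|𝔓)` for `Q ∣ 𝔓` in `T₁` (att-p5 g28 element certificate): `𝔓` RAMIFIES in `T₁`.
* §2 `forall_odd_ramificationIdx_divisionField_two_of_minimalDiscriminantInt_emod_eight_eq_five` (`2` inert in `ℚ(√Δ_min)`, `T/ℚ(√Δ_min)` Galois cubic ⟹ all
  `e(𝔓|2)` odd — att-p5 g27 §1–§2) and `totallyRamifiedFrom_zero_divisionField_two_of_onKilfordStratumAtTwo` (att-p3 g26: all `e = 1`), both feeding bsd-wall's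
  `totallyRamifiedFrom_zero_of_forall_odd_ramificationIdx_of_not_four_dvd`; **`totallyRamifiedFrom_zero_divisionField_two_of_isOrdinaryAt_two`** — UNIFORM:
  good ordinary at `2`, no rational `2`-torsion abscissa, `Δ_W ∉ ℚ²` ⟹ Fukuda's index is `0` for every cyclotomic `ℤ₂`-extension of `ℚ(W[2])`; hence the
  layer-pair doors `classicalMuVanishes_divisionField_two_of_classNumberPExp_succ_eq` / `…_of_classGroupPRank_succ_eq` (ANY pair `(n, n+1)`, `n ≥ 0`).

Nothing is asserted about any curve's class groups; nothing is closed; BSD is not proved.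

References: [NeukirchANT1999] Ch. I §8 Prop. (8.2), §9; [Washington1997] §13.1 Lemma 13.3; [Fukuda1994] Thm. 1, p. 264; [SilvermanAEC2009] VIII.§1; tree:
bsd-2adic / bsd-wall `CyclotomicTwoTotallyRamified{OddIndex,NoSqrtTwo}`, att-p3 g26, att-p5 g27/g28.
-/

set_option linter.dupNamespace false
set_option autoImplicit false

noncomputable section

open scoped Classical NumberField nonZeroDivisors

namespace Summit.BirchSwinnertonDyer.BirchSwinnertonDyer.Theorems.AlignedTransportAtTwoSexticFukudaIndex

open NumberField IsDedekindDomain Polynomial WeierstrassCurve IntermediateField Field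
  Literature.NumberTheory.IwasawaTheory Literature.NumberTheory.GaloisRepresentations
  Literature.NumberTheory.EllipticCurves Literature.NumberTheory.EllipticCurves.Greenberg1999
  Literature.NumberTheory.EllipticCurves.DokchitserDokchitser2012
  Summit.BirchSwinnertonDyer.Rank1Residual.F1Sign2
  Summit.BirchSwinnertonDyer.BirchSwinnertonDyer.Theorems.AlignedTransportAtTwoBridge
  Summit.BirchSwinnertonDyer.BirchSwinnertonDyer.Theorems.AlignedTransportAtTwoKilfordStratumShared
  Summit.BirchSwinnertonDyer.BirchSwinnertonDyer.Theorems.AlignedTransportAtTwoKilfordStratum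
  Summit.BirchSwinnertonDyer.BirchSwinnertonDyer.Theorems.AlignedTransportAtTwoFineRoad.DivisionCubic
  Summit.BirchSwinnertonDyer.BirchSwinnertonDyer.Theorems.AlignedTransportAtTwoFineRoad.TowerImageDelta
  Summit.BirchSwinnertonDyer.BirchSwinnertonDyer.Theorems.AlignedTransportAtTwoCubicResolventParity
  Summit.BirchSwinnertonDyer.BirchSwinnertonDyer.Theorems.AlignedTransportAtTwoCubicClosureParity
  Summit.BirchSwinnertonDyer.BirchSwinnertonDyer.Theorems.AlignedTransportAtTwoCubicOffStratumRamification
  Summit.BirchSwinnertonDyer.BirchSwinnertonDyer.Theorems.AlignedTransportAtTwoSexticTowerGrowth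
  Summit.BirchSwinnertonDyer.BirchSwinnertonDyer.Theorems.AlignedTransportAtTwoCubicOffStratumFukudaIndexTools
  Summit.BirchSwinnertonDyer.BirchSwinnertonDyer.Theorems.AlignedTransportAtTwoCubicOffStratumFukudaIndex

variable (W : WeierstrassCurve ℚ) [W.IsElliptic] [W.IsGloballyMinimal]

/-- `δ = 4δ₀ ∈ ℚ(W[2])` with `δ² = Δ_min` (as an element of the field `ℚ(W[2])`). [cite: SilvermanAEC2009, III.§1 and VIII.§1] -/
theorem exists_sq_eq_minimalDiscriminantInt_divisionField_two :
    ∃ d : ↥(W.divisionField 2), d ^ 2 = ((minimalDiscriminantInt W : ↥(W.divisionField 2))) := by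
  have h2 : (2 : ℚ) ≠ 0 := two_ne_zero
  have hδsq : (4 * delta W h2) ^ 2 = ((W.Δ : ℚ) : AlgebraicClosure ℚ) := four_mul_delta_sq W
  have hδT : 4 * delta W h2 ∈ W.divisionField 2 := by
    have hd : delta W h2 ∈ W.divisionField 2 := by
      change (xT W h2 0 - xT W h2 1) * (xT W h2 0 - xT W h2 2) * (xT W h2 1 - xT W h2 2) ∈ W.divisionField 2
      exact mul_mem (mul_mem (sub_mem (xT_mem_divisionField W h2 0) (xT_mem_divisionField W h2 1))
        (sub_mem (xT_mem_divisionField W h2 0) (xT_mem_divisionField W h2 2)))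
        (sub_mem (xT_mem_divisionField W h2 1) (xT_mem_divisionField W h2 2))
    exact mul_mem (ofNat_mem _ 4) hd
  refine ⟨⟨4 * delta W h2, hδT⟩, Subtype.ext ?_⟩
  rw [SubmonoidClass.coe_pow]
  change (4 * delta W h2) ^ 2 = _
  rw [hδsq, ← cast_minimalDiscriminantInt W]
  push_cast
  rfl

/-! ## §1 OFF the stratum, `Δ_min ≡ 3 (mod 4)`: `√2 ∉ ℚ(W[2])`, and every prime of `ℚ(W[2])` above `2` ramifies in `ℚ(W[2])(√2)` -/

/-- **`√2 ∉ ℚ(W[2])`** for `W` good ordinary at `2` with no rational `2`-torsion abscissa and `Δ_min ≡ 3 (mod 4)`: `√2, √Δ_min ∈ ℚ(W[2])` would force `4 ∣ e(𝔓|2)`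
for every prime above `2` (att-p5 g28 element certificate), but `e(𝔓|2) = 2` (`…CubicOffStratumFukudaIndex` §1). [cite: NeukirchANT1999, Ch. I §8 Prop. (8.2)] -/
theorem forall_sq_ne_two_divisionField_two_of_minimalDiscriminantInt_emod_four_eq_three (hord : IsOrdinaryAt W 2)
    (ht : ∀ x : ℚ, ¬ HasRationalTwoTorsionX W x) (h4 : minimalDiscriminantInt W % 4 = 3) [NumberField ↥(W.divisionField 2)] :
    ∀ x : ↥(W.divisionField 2), x ^ 2 ≠ 2 := by
  intro x hx
  obtain ⟨d, hd⟩ := exists_sq_eq_minimalDiscriminantInt_divisionField_two W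
  haveI : (Ideal.span {(2 : ℤ)}).IsMaximal :=
    Ideal.IsPrime.isMaximal ((Ideal.span_singleton_prime two_ne_zero).mpr Int.prime_two) (by simp)
  obtain ⟨⟨P, hPprime, hPover⟩⟩ := (inferInstance : Nonempty (Ideal.primesOver (Ideal.span {(2 : ℤ)}) (𝓞 ↥(W.divisionField 2))))
  haveI := hPprime
  haveI := hPover
  have h2P : (2 : 𝓞 ↥(W.divisionField 2)) ∈ P := by
    have := (Ideal.mem_of_liesOver P (Ideal.span {(2 : ℤ)}) (2 : ℤ)).mp (Ideal.mem_span_singleton_self 2)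
    simpa using this
  have h4dvd := four_dvd_ramificationIdx_of_sq_eq_two_of_sq_eq_intCast hx hd h4 P h2P
  rw [ramificationIdx_divisionField_two_eq_two_of_minimalDiscriminantInt_emod_four_eq_three W hord ht h4 P h2P] at h4dvd
  omega

set_option synthInstance.maxHeartbeats 200000 in
/-- **FUKUDA'S INDEX IS `0` FOR `ℚ(W[2])` OFF THE STRATUM (`Δ_min ≡ 3 (mod 4)`).** `W/ℚ` globally minimal, good ordinary at `2`, no rational `2`-torsion abscissa,
`Δ_min ≡ 3 (mod 4)`; `κ` any cyclotomic `ℤ₂`-extension of `T = ℚ(W[2])`: `TotallyRamifiedFrom κ 0`. The first layer `T₁ ∋ √2` (`4 ∤ [T:ℚ] = 6`, `√2 ∉ T`,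
bsd-wall `exists_sq_eq_two_layer_one_of_forall_sq_ne_two`) and `∋ √Δ_min`, so every prime `Q` of `T₁` above `2` has `4 ∣ e(Q|2) = e(𝔓|2)·e(Q|𝔓) = 2·e(Q|𝔓)`:
each `𝔓 ∣ 2` of `T` RAMIFIES in `T₁`, and the first-layer criterion concludes. (No inertia group is needed for the sextic: `√Δ_min` already lies in `T`.)
[cite: Washington1997, §13.1 Lemma 13.3 (proof)] [cite: Fukuda1994, p. 264 (the index `n₀`)] [cite: NeukirchANT1999, Ch. I §8 Prop. (8.2)] -/
theorem totallyRamifiedFrom_zero_divisionField_two_of_minimalDiscriminantInt_emod_four_eq_three (hord : IsOrdinaryAt W 2)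
    (ht : ∀ x : ℚ, ¬ HasRationalTwoTorsionX W x) (h4 : minimalDiscriminantInt W % 4 = 3) [NumberField ↥(W.divisionField 2)]
    (κ : ZpExtension ↥(W.divisionField 2) 2) (hκ : κ.IsCyclotomic) : TotallyRamifiedFrom κ 0 := by
  have hΔ : ¬ IsSquare W.Δ := not_isSquare_Δ_of_emod_eight W (by omega)
  have hT4 : ¬ 4 ∣ Module.finrank ℚ ↥(W.divisionField 2) := by rw [finrank_divisionField_two_eq_six W ht hΔ]; decide
  have hsq := forall_sq_ne_two_divisionField_two_of_minimalDiscriminantInt_emod_four_eq_three W hord ht h4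
  haveI : FiniteDimensional ↥(W.divisionField 2) (κ.layer 1) := κ.finiteDimensional_layer_holds 1
  haveI : NumberField (κ.layer 1) := NumberField.of_module_finite ↥(W.divisionField 2) _
  obtain ⟨θ, hθ⟩ := exists_sq_eq_two_layer_one_of_forall_sq_ne_two hT4 hsq κ hκ
  obtain ⟨d, hd⟩ := exists_sq_eq_minimalDiscriminantInt_divisionField_two W
  have hd₁ : (algebraMap ↥(W.divisionField 2) (κ.layer 1) d) ^ 2 = ((minimalDiscriminantInt W : κ.layer 1)) := by
    rw [← map_pow, hd, map_intCast]
  refine totallyRamifiedFrom_zero_of_forall_not_isUnramifiedIn_layer_one κ fun w hw2 hunr => ?_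
  haveI : w.asIdeal.IsPrime := w.isPrime
  haveI : w.asIdeal.IsMaximal := w.isMaximal
  have hw2' : (2 : 𝓞 ↥(W.divisionField 2)) ∈ w.asIdeal := by exact_mod_cast hw2
  have hew : w.asIdeal.ramificationIdx ℤ = 2 :=
    ramificationIdx_divisionField_two_eq_two_of_minimalDiscriminantInt_emod_four_eq_three W hord ht h4 w.asIdeal hw2'
  obtain ⟨⟨Q, hQprime, hQover⟩⟩ := (inferInstance : Nonempty (Ideal.primesOver w.asIdeal (𝓞 (κ.layer 1))))
  haveI := hQprime
  haveI := hQover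
  have h2Q : (2 : 𝓞 (κ.layer 1)) ∈ Q := by
    have := (Ideal.mem_of_liesOver Q w.asIdeal (2 : 𝓞 ↥(W.divisionField 2))).mp hw2'
    rwa [map_ofNat] at this
  have h4Q := four_dvd_ramificationIdx_of_sq_eq_two_of_sq_eq_intCast hθ hd₁ h4 Q h2Q
  have h1 : Q.ramificationIdx (𝓞 ↥(W.divisionField 2)) = 1 := hunr.ramificationIdx_eq_one hQover
  rw [Ideal.ramificationIdx_tower w.asIdeal Q, hew, h1] at h4Q
  omega

/-! ## §2 The other strata and the UNIFORM statement -/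

/-- **`Δ_min ≡ 5 (mod 8)`: every prime of `ℚ(W[2])` above `2` has ODD ramification index** (`W` globally minimal; `2` is inert in the resolvent `ℚ(√Δ_min)`,
`e = 1` there — att-p5 g27 §2 —, and `T/ℚ(√Δ_min)` is Galois of odd degree `3`, so `e(𝔓|𝔮)` is odd — g27 §1). [cite: NeukirchANT1999, Ch. I §8–§9]
[cite: Marcus2018, Ch. 3 Thm. 25, Ch. 4] -/
theorem forall_odd_ramificationIdx_divisionField_two_of_minimalDiscriminantInt_emod_eight_eq_five
    (ht : ∀ x : ℚ, ¬ HasRationalTwoTorsionX W x) (h8 : minimalDiscriminantInt W % 8 = 5) [NumberField ↥(W.divisionField 2)] :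
    ∀ w : HeightOneSpectrum (𝓞 ↥(W.divisionField 2)), ((2 : ℕ) : 𝓞 ↥(W.divisionField 2)) ∈ w.asIdeal →
      Odd (w.asIdeal.ramificationIdx ℤ) := by
  intro w hw
  have h2 : (2 : ℚ) ≠ 0 := two_ne_zero
  haveI : IsGalois ℚ (W.divisionField 2) := W.isGalois_divisionField 2
  have hΔ : ¬ IsSquare W.Δ := not_isSquare_Δ_of_emod_eight W (by omega)
  obtain ⟨δ, hδdef⟩ : ∃ δ : AlgebraicClosure ℚ, δ = 4 * delta W h2 := ⟨_, rfl⟩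
  have hδsq : δ ^ 2 = ((W.Δ : ℚ) : AlgebraicClosure ℚ) := by rw [hδdef]; exact four_mul_delta_sq W
  have hδT : δ ∈ W.divisionField 2 := by
    rw [hδdef]
    have hd : delta W h2 ∈ W.divisionField 2 := by
      change (xT W h2 0 - xT W h2 1) * (xT W h2 0 - xT W h2 2) * (xT W h2 1 - xT W h2 2) ∈ W.divisionField 2
      exact mul_mem (mul_mem (sub_mem (xT_mem_divisionField W h2 0) (xT_mem_divisionField W h2 1))
        (sub_mem (xT_mem_divisionField W h2 0) (xT_mem_divisionField W h2 2)))
        (sub_mem (xT_mem_divisionField W h2 1) (xT_mem_divisionField W h2 2))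
    exact mul_mem (ofNat_mem _ 4) hd
  have hK : ℚ⟮δ⟯ ≤ W.divisionField 2 := adjoin_simple_le_iff.mpr hδT
  letI algK : Algebra ℚ⟮δ⟯ (W.divisionField 2) := (IntermediateField.inclusion hK).toRingHom.toAlgebra
  haveI : IsScalarTower ℚ ℚ⟮δ⟯ (W.divisionField 2) :=
    IsScalarTower.of_algebraMap_eq fun q ↦ ((IntermediateField.inclusion hK).commutes q).symm
  have hδint : IsIntegral ℚ δ := ((AlgebraicClosure.isAlgebraic ℚ).isAlgebraic δ).isIntegral
  haveI : FiniteDimensional ℚ ℚ⟮δ⟯ := IntermediateField.adjoin.finiteDimensional hδint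
  haveI : NumberField ℚ⟮δ⟯ := NumberField.mk
  haveI : IsGalois ℚ⟮δ⟯ (W.divisionField 2) := IsGalois.tower_top_of_isGalois ℚ ℚ⟮δ⟯ (W.divisionField 2)
  haveI : FiniteDimensional ℚ⟮δ⟯ (W.divisionField 2) := Module.Finite.of_restrictScalars_finite ℚ _ _
  have hK2 : Module.finrank ℚ ℚ⟮δ⟯ = 2 := finrank_adjoin_eq_two_of_sq_eq hδsq hΔ
  have hodd3 : Odd (Module.finrank ℚ⟮δ⟯ (W.divisionField 2)) := by
    have hmul := Module.finrank_mul_finrank ℚ ℚ⟮δ⟯ (W.divisionField 2)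
    rw [hK2, finrank_divisionField_two_eq_six W ht hΔ] at hmul
    have : Module.finrank ℚ⟮δ⟯ (W.divisionField 2) = 3 := by omega
    rw [this]; decide
  -- the prime of `ℚ(δ)` below `w` has `e = 1`
  haveI : w.asIdeal.IsPrime := w.isPrime
  have hgen := gen_sq_eq_minimalDiscriminantInt W hδsq
  have h2q : (2 : 𝓞 ℚ⟮δ⟯) ∈ w.asIdeal.under (𝓞 ℚ⟮δ⟯) := by
    rw [Ideal.under_def, Ideal.mem_comap, map_ofNat]; exact_mod_cast hw
  have he1 := (ramificationIdx_eq_one_and_inertiaDeg_eq_two_of_sq_eq_of_emod_eight_eq_five hK2 hgen h8 (w.asIdeal.under (𝓞 ℚ⟮δ⟯)) h2q).1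
  have hoddrel := (odd_ramificationIdx_and_inertiaDeg_of_isGalois (K₂ := ℚ⟮δ⟯) hodd3 w.asIdeal).1
  haveI : NoZeroSMulDivisors (𝓞 ℚ⟮δ⟯) (𝓞 ↥(W.divisionField 2)) := ⟨fun h => smul_eq_zero.mp h⟩
  rw [Ideal.ramificationIdx_tower (w.asIdeal.under (𝓞 ℚ⟮δ⟯)) w.asIdeal, he1, one_mul]
  exact hoddrel

/-- **Fukuda's index is `0` for `ℚ(W[2])` on `Δ_min ≡ 5 (mod 8)`** (all `e(𝔓|2)` odd, `4 ∤ 6`; bsd-wall's criterion). [cite: Fukuda1994, p. 264]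
[cite: Washington1997, §13.1 Lemma 13.3] -/
theorem totallyRamifiedFrom_zero_divisionField_two_of_minimalDiscriminantInt_emod_eight_eq_five
    (ht : ∀ x : ℚ, ¬ HasRationalTwoTorsionX W x) (h8 : minimalDiscriminantInt W % 8 = 5) [NumberField ↥(W.divisionField 2)]
    (κ : ZpExtension ↥(W.divisionField 2) 2) (hκ : κ.IsCyclotomic) : TotallyRamifiedFrom κ 0 := by
  have hΔ : ¬ IsSquare W.Δ := not_isSquare_Δ_of_emod_eight W (by omega)
  have hT4 : ¬ 4 ∣ Module.finrank ℚ ↥(W.divisionField 2) := by rw [finrank_divisionField_two_eq_six W ht hΔ]; decide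
  exact totallyRamifiedFrom_zero_of_forall_odd_ramificationIdx_of_not_four_dvd hT4 κ hκ
    (forall_odd_ramificationIdx_divisionField_two_of_minimalDiscriminantInt_emod_eight_eq_five W ht h8)

omit [W.IsGloballyMinimal] in
/-- **Fukuda's index is `0` for `ℚ(W[2])` ON the Kilford stratum** (`Δ_W ∉ ℚ²`, no rational `2`-torsion abscissa: every prime above `2` has `e = 1` — att-p3 g26 —,
`4 ∤ 6`). [cite: Fukuda1994, p. 264] [cite: Washington1997, §13.1 Lemma 13.3] -/
theorem totallyRamifiedFrom_zero_divisionField_two_of_onKilfordStratumAtTwo (ht : ∀ x : ℚ, ¬ HasRationalTwoTorsionX W x) (hΔ : ¬ IsSquare W.Δ)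
    (hs : OnKilfordStratumAtTwo W) [NumberField ↥(W.divisionField 2)]
    (κ : ZpExtension ↥(W.divisionField 2) 2) (hκ : κ.IsCyclotomic) : TotallyRamifiedFrom κ 0 := by
  have hT4 : ¬ 4 ∣ Module.finrank ℚ ↥(W.divisionField 2) := by rw [finrank_divisionField_two_eq_six W ht hΔ]; decide
  refine totallyRamifiedFrom_zero_of_forall_odd_ramificationIdx_of_not_four_dvd hT4 κ hκ fun w hw => ?_
  rw [(ramificationIdx_eq_one_and_inertiaDeg_eq_one_divisionField_two W hs w hw).1]
  exact odd_one

/-- **FUKUDA'S INDEX IS `0` FOR `ℚ(W[2])`, EVERY GOOD-ORDINARY SEED-CELL CURVE** with no rational `2`-torsion abscissa and `Δ_W ∉ ℚ²`: every cyclotomic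
`ℤ₂`-extension `κ` of `ℚ(W[2])` has `TotallyRamifiedFrom κ 0` (`Δ_min ≡ 1 (8)`: ON the stratum; `≡ 5 (8)`: all `e` odd; `≡ 3 (4)`: §1).
[cite: Fukuda1994, p. 264 (the index `n₀`)] [cite: Washington1997, §13.1 Lemma 13.3] [cite: NeukirchANT1999, Ch. I §8–§9] -/
theorem totallyRamifiedFrom_zero_divisionField_two_of_isOrdinaryAt_two (hord : IsOrdinaryAt W 2) (ht : ∀ x : ℚ, ¬ HasRationalTwoTorsionX W x)
    (hΔ : ¬ IsSquare W.Δ) [NumberField ↥(W.divisionField 2)]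
    (κ : ZpExtension ↥(W.divisionField 2) 2) (hκ : κ.IsCyclotomic) : TotallyRamifiedFrom κ 0 := by
  have h2 : ¬ (2 : ℤ) ∣ minimalDiscriminantInt W := by
    exact_mod_cast W.not_dvd_minimalDiscriminantInt_of_hasGoodReductionAtPrime 2 hord.1
  by_cases h4 : minimalDiscriminantInt W % 4 = 3
  · exact totallyRamifiedFrom_zero_divisionField_two_of_minimalDiscriminantInt_emod_four_eq_three W hord ht h4 κ hκ
  · by_cases h8 : minimalDiscriminantInt W % 8 = 1
    · exact totallyRamifiedFrom_zero_divisionField_two_of_onKilfordStratumAtTwo W ht hΔ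
        ((onKilfordStratumAtTwo_iff_minimalDiscriminantInt_emod_eight W hord).mpr h8) κ hκ
    · exact totallyRamifiedFrom_zero_divisionField_two_of_minimalDiscriminantInt_emod_eight_eq_five W ht (by omega) κ hκ

/-- **THE SEXTIC CLASS-NUMBER DOOR AT ANY LAYER PAIR.** `W` good ordinary at `2`, no rational `2`-torsion abscissa, `Δ_W ∉ ℚ²`, `κ` a cyclotomic `ℤ₂`-extension
of `ℚ(W[2])`: ONE pair `(n, n+1)`, ANY `n ≥ 0`, with `e_{n+1}(κ) = e_n(κ)` ⟹ `μ₂(ℚ(W[2])^{cyc}) = 0` (Fukuda Thm. 1 (1), index `0`). On the Kilford stratum with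
`Δ_W < 0` such a pair never exists (att-p3 g26 `not_exists_classNumberPExp_succ_eq_divisionField_two`); OFF the stratum it may. [cite: Fukuda1994, Thm. 1 (1), p. 264] -/
theorem classicalMuVanishes_divisionField_two_of_classNumberPExp_succ_eq (hord : IsOrdinaryAt W 2) (ht : ∀ x : ℚ, ¬ HasRationalTwoTorsionX W x)
    (hΔ : ¬ IsSquare W.Δ) [NumberField ↥(W.divisionField 2)]
    (κ : ZpExtension ↥(W.divisionField 2) 2) (hκ : κ.IsCyclotomic) {n : ℕ} (he : classNumberPExp κ (n + 1) = classNumberPExp κ n) :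
    ClassicalMuVanishes κ :=
  classicalMuVanishes_of_classNumberPExp_succ_eq' κ (totallyRamifiedFrom_zero_divisionField_two_of_isOrdinaryAt_two W hord ht hΔ κ hκ)
    (Nat.zero_le n) he

/-- **THE SEXTIC RANK DOOR AT ANY LAYER PAIR.** Same hypotheses; ONE pair `(n, n+1)`, ANY `n ≥ 0`, with `rank₂ Cl(ℚ(W[2])_{n+1}) = rank₂ Cl(ℚ(W[2])_n)` ⟹
`μ₂(ℚ(W[2])^{cyc}) = 0` (Fukuda Thm. 1 (2), index `0`) — the certificate shape att-p3 g26 / REF1 R280c single out for the sextic carrier.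
[cite: Fukuda1994, Thm. 1 (2), p. 264] -/
theorem classicalMuVanishes_divisionField_two_of_classGroupPRank_succ_eq (hord : IsOrdinaryAt W 2) (ht : ∀ x : ℚ, ¬ HasRationalTwoTorsionX W x)
    (hΔ : ¬ IsSquare W.Δ) [NumberField ↥(W.divisionField 2)]
    (κ : ZpExtension ↥(W.divisionField 2) 2) (hκ : κ.IsCyclotomic) {n : ℕ} (hr : classGroupPRank κ (n + 1) = classGroupPRank κ n) :
    ClassicalMuVanishes κ :=
  classicalMuVanishes_of_classGroupPRank_succ_eq' κ (totallyRamifiedFrom_zero_divisionField_two_of_isOrdinaryAt_two W hord ht hΔ κ hκ)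
    (Nat.zero_le n) hr

end Summit.BirchSwinnertonDyer.BirchSwinnertonDyer.Theorems.AlignedTransportAtTwoSexticFukudaIndex

end
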